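import Summits.RiemannHypothesis.RiemannHypothesis.Theorems.PfPersistenceEdgeLawCuspInterior
import Summits.RiemannHypothesis.RiemannHypothesis.Theorems.PfPersistenceEdgeLawCuspDeriv

/-!
# Edge law — building cusp remainders: sums, one-sided interior cusps, non-vacuity

Part of the pub-rhpf THEORY-2 programme (mechanism / rigidity of the Weil window bottom; no RH
claims). The cusp modulus with remainder `HasCuspModulusWith a u C Ξ`, `IsCuspRemainder Ξ ω`
(file `PfPersistenceEdgeLawCuspInterior`) is meant to absorb finitely many ONE-SIDED INTERIOR
CUSPS of a window ground state (at `±(a − log q)`, transported from the edge by the prime shifts of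
the Euler–Lagrange equation). This file provides the constructors for such remainders and shows
the hypothesis class is genuinely larger than the gen-6 cusp modulus class:

* `IsCuspRemainder.add`, `HasCuspModulusWith.add` — remainders and moduli add;
* `IsCuspRemainder.oneSided` — a one-sided cusp `x ↦ φ((x − x₀)₊)` with a monotone subadditive
  Dini–log profile `φ` (`φ(0) = 0`, `φ(p+s) ≤ φ(p) + φ(s)`, `φ(s) log(1/s) → 0`) is a remainder
  with modulus `φ`;
* `cuspBump φ x₀ x₁` — the real bump `φ((x−x₀)₊) − φ((x−x₁)₊)` (rises with a cusp at `x₀`, returns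
  to `0` after `x₁ + ℓ` when `φ` is capped at `ℓ`): `hasCuspModulusWith_cuspBump` (constant `0`,
  remainder the sum of the two one-sided cusps);
* the concrete capped square-root profile `sqrtCap ℓ s = √(min s ℓ)` qualifies
  (`isCuspRemainder_sqrtCap`), whence the NON-VACUITY WITNESS
  `hasCuspModulusWith_cuspModel_add_bump`: the gen-6 cusp model plus an interior square-root bump
  has a cusp modulus with remainder (it is not locally Lipschitz at `x₀`, so it has no cusp modulus
  in the gen-6 sense; that negative half is not formalised).

Sources: E. Bombieri, *Remarks on Weil's quadratic functional in the theory of prime numbers I*,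
Rend. Mat. Acc. Lincei (9) 11 (2000) §4, §6 (the objects); the constructions are folklore real
analysis.
-/

set_option linter.dupNamespace false

noncomputable section

open MeasureTheory Set Filter
open scoped Topology

namespace Summit.RiemannHypothesis.RiemannHypothesis.Theorems.PfPersistence

open Literature.NumberTheory.LFunctions

variable {a : ℝ}

/-! ## Sums -/

/-- Remainders add. [folklore] -/
theorem IsCuspRemainder.add {Ξ₁ ω₁ Ξ₂ ω₂ : ℝ → ℝ} (h₁ : IsCuspRemainder Ξ₁ ω₁)
    (h₂ : IsCuspRemainder Ξ₂ ω₂) :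
    IsCuspRemainder (fun x ↦ Ξ₁ x + Ξ₂ x) (fun s ↦ ω₁ s + ω₂ s) where
  mono := fun x y hxy ↦ add_le_add (h₁.mono hxy) (h₂.mono hxy)
  sub_le := fun x s hs ↦ by linarith [h₁.sub_le x s hs, h₂.sub_le x s hs]
  modulus_mono := fun s t hst ↦ add_le_add (h₁.modulus_mono hst) (h₂.modulus_mono hst)
  dini := by
    have h := h₁.dini.add h₂.dini
    rw [add_zero] at h
    exact h.congr fun s ↦ by ring

/-- `weilTrunc` is additive. [folklore] -/
theorem weilTrunc_add (a : ℝ) (u v : ℝ → ℂ) :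
    weilTrunc a (u + v) = weilTrunc a u + weilTrunc a v := by
  funext x
  simp only [weilTrunc, Pi.add_apply, indicator_apply]
  split_ifs <;> simp

/-- Cusp moduli with remainder add. [folklore] -/
theorem HasCuspModulusWith.add {u v : ℝ → ℂ} {C₁ C₂ : ℝ} {Ξ₁ Ξ₂ : ℝ → ℝ}
    (hu : HasCuspModulusWith a u C₁ Ξ₁) (hv : HasCuspModulusWith a v C₂ Ξ₂) :
    HasCuspModulusWith a (u + v) (C₁ + C₂) (fun x ↦ Ξ₁ x + Ξ₂ x) := by
  intro x y hx hxy hy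
  have h1 := hu hx hxy hy
  have h2 := hv hx hxy hy
  rw [weilTrunc_add]
  simp only [Pi.add_apply]
  calc ‖weilTrunc a u y + weilTrunc a v y - (weilTrunc a u x + weilTrunc a v x)‖
      = ‖(weilTrunc a u y - weilTrunc a u x) + (weilTrunc a v y - weilTrunc a v x)‖ := by
        congr 1; ring
    _ ≤ ‖weilTrunc a u y - weilTrunc a u x‖ + ‖weilTrunc a v y - weilTrunc a v x‖ :=
        norm_add_le _ _
    _ ≤ _ := by linarith

/-! ## One-sided interior cusps -/

/-- **A one-sided cusp is a remainder.** For a monotone, subadditive profile `φ` with `φ(0) = 0`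
and `φ(s) log(1/s) → 0`, the one-sided cusp `Ξ(x) = φ((x − x₀)₊)` at any `x₀` is a cusp
remainder with modulus `s ↦ φ(s₊)`. [folklore] -/
theorem IsCuspRemainder.oneSided {φ : ℝ → ℝ} (hmono : Monotone φ)
    (hsub : ∀ p s, 0 ≤ p → 0 ≤ s → φ (p + s) ≤ φ p + φ s)
    (hdini : Tendsto (fun s ↦ φ s * Real.log (1 / s)) (𝓝[>] 0) (𝓝 0)) (x₀ : ℝ) :
    IsCuspRemainder (fun x ↦ φ (max (x - x₀) 0)) (fun s ↦ φ (max s 0)) where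
  mono := fun x y hxy ↦ hmono (max_le_max (by linarith) le_rfl)
  sub_le := fun x s hs ↦ by
    have hp0 : 0 ≤ max (x - x₀) 0 := le_max_right _ _
    have h1 : max (x + s - x₀) 0 ≤ max (x - x₀) 0 + s :=
      max_le (by linarith [le_max_left (x - x₀) 0]) (by linarith)
    have h2 := hmono h1
    have h3 := hsub _ s hp0 hs
    rw [max_eq_left hs]
    linarith
  modulus_mono := fun s t hst ↦ hmono (max_le_max hst le_rfl)
  dini := by
    refine hdini.congr' ?_
    filter_upwards [self_mem_nhdsWithin] with s hs
    rw [mem_Ioi] at hs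
    rw [max_eq_left hs.le]

/-- The **interior cusp bump** `φ((x − x₀)₊) − φ((x − x₁)₊)` (real-valued, as a complex
function). [folklore] -/
def cuspBump (φ : ℝ → ℝ) (x₀ x₁ : ℝ) : ℝ → ℂ :=
  fun x ↦ ((φ (max (x - x₀) 0) - φ (max (x - x₁) 0) : ℝ) : ℂ)

/-- A bump with a profile capped at `ℓ ≥ 0` vanishes off `(−a, a)` when `−a ≤ x₀ ≤ x₁` and
`x₁ + ℓ ≤ a`. [folklore] -/
theorem cuspBump_eq_zero {φ : ℝ → ℝ} {ℓ x₀ x₁ : ℝ} (hcap : ∀ s, ℓ ≤ s → φ s = φ ℓ)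
    (hℓ : 0 ≤ ℓ) (hx₀ : -a ≤ x₀) (h01 : x₀ ≤ x₁) (hx₁ : x₁ + ℓ ≤ a) {x : ℝ} (hx : a ≤ |x|) :
    cuspBump φ x₀ x₁ x = 0 := by
  unfold cuspBump
  rcases le_abs.1 hx with h | h
  · rw [max_eq_left (by linarith), max_eq_left (by linarith), hcap (x - x₀) (by linarith),
      hcap (x - x₁) (by linarith), sub_self, Complex.ofReal_zero]
  · rw [max_eq_right (by linarith), max_eq_right (by linarith), sub_self, Complex.ofReal_zero]

/-- **The bump has a cusp modulus with remainder** (constant `0`; remainder = the two one-sided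
cusps). [folklore] -/
theorem hasCuspModulusWith_cuspBump {φ : ℝ → ℝ} {ℓ x₀ x₁ : ℝ} (hmono : Monotone φ)
    (hcap : ∀ s, ℓ ≤ s → φ s = φ ℓ) (hℓ : 0 ≤ ℓ) (hx₀ : -a ≤ x₀) (h01 : x₀ ≤ x₁)
    (hx₁ : x₁ + ℓ ≤ a) :
    HasCuspModulusWith a (cuspBump φ x₀ x₁) 0
      (fun x ↦ φ (max (x - x₀) 0) + φ (max (x - x₁) 0)) := by
  intro x y hx hxy hy
  rw [weilTrunc_eq_self fun z hz ↦ cuspBump_eq_zero hcap hℓ hx₀ h01 hx₁ hz, zero_mul, zero_add]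
  have m0 : φ (max (x - x₀) 0) ≤ φ (max (y - x₀) 0) := hmono (max_le_max (by linarith) le_rfl)
  have m1 : φ (max (x - x₁) 0) ≤ φ (max (y - x₁) 0) := hmono (max_le_max (by linarith) le_rfl)
  unfold cuspBump
  rw [← Complex.ofReal_sub, Complex.norm_real, Real.norm_eq_abs]
  exact abs_le.2 ⟨by linarith, by linarith⟩

/-! ## A concrete profile: the capped square root -/

/-- The capped square-root profile `√(min s ℓ)`. [folklore] -/
def sqrtCap (ℓ s : ℝ) : ℝ := Real.sqrt (min s ℓ)

/-- `sqrtCap` is monotone. [folklore] -/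
theorem sqrtCap_monotone (ℓ : ℝ) : Monotone (sqrtCap ℓ) :=
  fun _ _ hst ↦ Real.sqrt_le_sqrt (min_le_min_right ℓ hst)

/-- `sqrtCap` is capped at `ℓ`. [folklore] -/
theorem sqrtCap_cap {ℓ s : ℝ} (hs : ℓ ≤ s) : sqrtCap ℓ s = sqrtCap ℓ ℓ := by
  simp [sqrtCap, min_eq_right hs]

/-- `sqrtCap` is subadditive on `[0, ∞)`. [folklore] -/
theorem sqrtCap_subadditive (ℓ : ℝ) {p s : ℝ} (hp : 0 ≤ p) (hs : 0 ≤ s) :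
    sqrtCap ℓ (p + s) ≤ sqrtCap ℓ p + sqrtCap ℓ s := by
  unfold sqrtCap
  have h0p := Real.sqrt_nonneg (min p ℓ)
  have h0s := Real.sqrt_nonneg (min s ℓ)
  rcases le_or_gt ℓ p with hℓp | hℓp
  · have : Real.sqrt (min (p + s) ℓ) ≤ Real.sqrt (min p ℓ) := by
      rw [min_eq_right hℓp]; exact Real.sqrt_le_sqrt (min_le_right _ _)
    linarith
  rcases le_or_gt ℓ s with hℓs | hℓs
  · have : Real.sqrt (min (p + s) ℓ) ≤ Real.sqrt (min s ℓ) := by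
      rw [min_eq_right hℓs]; exact Real.sqrt_le_sqrt (min_le_right _ _)
    linarith
  rw [min_eq_left hℓp.le, min_eq_left hℓs.le]
  -- `√(p + s) ≤ √p + √s`
  have hA := Real.sqrt_nonneg p
  have hB := Real.sqrt_nonneg s
  have e : p + s ≤ (Real.sqrt p + Real.sqrt s) ^ 2 := by
    nlinarith [Real.sq_sqrt hp, Real.sq_sqrt hs, mul_nonneg hA hB]
  have key : Real.sqrt (p + s) ≤ Real.sqrt p + Real.sqrt s :=
    calc Real.sqrt (p + s) ≤ Real.sqrt ((Real.sqrt p + Real.sqrt s) ^ 2) := Real.sqrt_le_sqrt e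
      _ = Real.sqrt p + Real.sqrt s := Real.sqrt_sq (by positivity)
  exact (Real.sqrt_le_sqrt (min_le_left _ _)).trans key

/-- The Dini–log condition for `sqrtCap`: `√(min s ℓ)·log(1/s) → 0` (`ℓ > 0`). [folklore] -/
theorem tendsto_sqrtCap_mul_log {ℓ : ℝ} (hℓ : 0 < ℓ) :
    Tendsto (fun s ↦ sqrtCap ℓ s * Real.log (1 / s)) (𝓝[>] 0) (𝓝 0) := by
  have h := (tendsto_log_mul_rpow_nhdsGT_zero (r := 1 / 2) (by norm_num)).neg
  rw [neg_zero] at h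
  refine h.congr' ?_
  filter_upwards [Ioo_mem_nhdsGT hℓ] with s hs
  rw [sqrtCap, min_eq_left hs.2.le, Real.sqrt_eq_rpow, one_div s, Real.log_inv]
  ring

/-- **The square-root cusp is a remainder.** [folklore] -/
theorem isCuspRemainder_sqrtCap {ℓ : ℝ} (hℓ : 0 < ℓ) (x₀ : ℝ) :
    IsCuspRemainder (fun x ↦ sqrtCap ℓ (max (x - x₀) 0)) (fun s ↦ sqrtCap ℓ (max s 0)) :=
  IsCuspRemainder.oneSided (sqrtCap_monotone ℓ) (fun _ _ hp hs ↦ sqrtCap_subadditive ℓ hp hs)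
    (tendsto_sqrtCap_mul_log hℓ) x₀

/-! ## Non-vacuity beyond the cusp modulus -/

/-- **Non-vacuity witness with an interior cusp.** The gen-6 cusp model `G(a)² − Γ(x)²` plus an
interior square-root bump (`−a ≤ x₀ ≤ x₁`, `x₁ + ℓ ≤ a`, `ℓ > 0`) has a cusp modulus WITH
REMAINDER (constant `2G(a)`, remainder = the two one-sided square-root cusps, modulus
`2√(min s₊ ℓ)`), although it is not locally Lipschitz at `x₀`. [folklore] -/
theorem hasCuspModulusWith_cuspModel_add_bump (ha : 0 < a) {ℓ x₀ x₁ : ℝ} (hℓ : 0 < ℓ)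
    (hx₀ : -a ≤ x₀) (h01 : x₀ ≤ x₁) (hx₁ : x₁ + ℓ ≤ a) :
    ∃ Ξ ω : ℝ → ℝ, IsCuspRemainder Ξ ω ∧
      HasCuspModulusWith a (cuspModel a + cuspBump (sqrtCap ℓ) x₀ x₁) (2 * cuspPrim a a) Ξ := by
  have hb := hasCuspModulusWith_cuspBump (a := a) (sqrtCap_monotone ℓ) (fun s hs ↦ sqrtCap_cap hs)
    hℓ.le hx₀ h01 hx₁
  have hm := (hasCuspModulus_cuspModel ha).hasCuspModulusWith
  have hsum := hm.add hb
  refine ⟨_, _, (isCuspRemainder_sqrtCap hℓ x₀).add (isCuspRemainder_sqrtCap hℓ x₁), ?_⟩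
  simpa only [add_zero, zero_add] using hsum

end Summit.RiemannHypothesis.RiemannHypothesis.Theorems.PfPersistence

end
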